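import Mathlib
import Summits.KontsevichZagierPeriods.KontsevichZagierPeriods.Theorems.UnfoldedStokesHyperellipticRiemannRelationStubBoundsAux

/-!
# `HyperellipticRiemannRelation` (stmt-KontsevichZagierPeriods-3522), line `SketchIdeator2`:
# stub `stub_bounds` — pointwise kernel bounds and integrable weights

Registered stub `stub_bounds` of the line skeleton.  For the branch points `e₀ < ⋯ < e₄`
(rational), `Φ(z) = ∏ⱼ √(z − eⱼ)` (principal square roots) and `z = x + is` with `s ≥ 0` and
`x ∉ {eⱼ}`, the four kernel quantities `1/Φ`, `z/Φ`, `Φ⁻¹ Σⱼ (z−eⱼ)⁻¹`,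
`(1 − (z/2) Σⱼ (z−eⱼ)⁻¹)/Φ` are dominated by `C m(x) ν(s)` with the `x`-weight
`m(x) = (1 + Σₖ |x−eₖ|^{-3/4}) (1+x²)^{-5/8}` (integrable on `ℝ`) and explicit height factors;
the two height weights `(1+s^{-3/4})(1+s²)^{-5/8}`, `(1+s^{-3/4})(1+s²)^{-5/4}` are integrable on
`(0,∞)`.

Proof.  The two MASTER BOUNDS of the sibling file
`UnfoldedStokesHyperellipticRiemannRelationStubBoundsAux.lean` (`stub_boundsAux`:
`‖Φ(z)⁻¹‖ ≤ A⁵DS (1+|z|²)^{-5/4}`, `‖Φ(z)⁻¹‖ Σⱼ|z−eⱼ|⁻¹ ≤ 5A⁵DS (1+s^{-3/4})(1+|z|²)^{-7/4}`,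
`S = 1 + Σₖ|x−eₖ|^{-3/4}`) are distributed by `(1+|z|²)^{-(p+q)} ≤ (1+x²)^{-p}(1+s²)^{-q}` and
`|z| ≤ (1+|z|²)^{1/2}`, with `‖1 − (z/2)Σⱼ(z−eⱼ)⁻¹‖ ≤ 1 + (|z|/2) Σⱼ|z−eⱼ|⁻¹`; `C = 5A⁵D`.
Integrability: `|y|^{-3/4}` is integrable on the unit ball of `ℝ` (`3/4 < 1 = dim`,
`integrableOn_ball_of_norm_le_rpow`), `(1+x²)^{-5/8}` on `ℝ` (`5/4 > 1`,
`integrable_rpow_neg_one_add_norm_sq`), and `m` is a translate-sum of products of these dominated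
by their sum; on `(0,∞)` split at `1`: `s^{-3/4}` is integrable on `(0,1]` and
`(1+s²)^{q} ≤ s^{2q}` on `(1,∞)` (`2q < -1`).  No definitions are introduced.  Mathlib only.
[folklore]
-/

noncomputable section

namespace Summit.KontsevichZagierPeriods.UnfoldedStokes.HyperellipticRiemannRelationLine

open Set MeasureTheory Filter Topology

namespace Bounds

/-! ## Integrability of the weights -/

/-- `(1 + x²)^{-5/8}` is integrable on `ℝ` (`5/4 > 1 = dim ℝ`). [folklore] -/
theorem integrable_bracket : Integrable (fun x : ℝ => (1 + x ^ 2) ^ (-(5:ℝ) / 8)) := by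
  have := integrable_rpow_neg_one_add_norm_sq (E := ℝ) (μ := volume) (r := 5 / 4)
    (by simp; norm_num)
  refine this.congr (ae_of_all _ fun x => ?_)
  simp only [Real.norm_eq_abs, sq_abs]
  norm_num

/-- `|y|^{-3/4}` is integrable on the unit ball of `ℝ` (`3/4 < 1 = dim ℝ`). [folklore] -/
theorem integrableOn_abs_rpow_ball :
    IntegrableOn (fun y : ℝ => |y| ^ (-(3:ℝ) / 4)) (Metric.ball 0 1) := by
  refine integrableOn_ball_of_norm_le_rpow (μ := volume) (by simp) (C := 1) (α := 3 / 4)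
    (by simp; norm_num) (ae_of_all _ fun y => ?_) (by fun_prop : Measurable _).aestronglyMeasurable
  rw [one_mul, Real.norm_eq_abs, Real.norm_eq_abs,
    abs_of_nonneg (Real.rpow_nonneg (abs_nonneg y) _)]
  apply le_of_eq
  norm_num

/-- `|x − c|^{-3/4} (1+x²)^{-5/8}` is integrable on `ℝ`. [folklore] -/
theorem integrable_weight_term (c : ℝ) :
    Integrable (fun x : ℝ => |x - c| ^ (-(3:ℝ) / 4) * (1 + x ^ 2) ^ (-(5:ℝ) / 8)) := by
  have key : Integrable (fun y : ℝ => |y| ^ (-(3:ℝ) / 4) * (1 + (y + c) ^ 2) ^ (-(5:ℝ) / 8)) := by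
    have h1 : Integrable ((Metric.ball (0:ℝ) 1).indicator (fun y : ℝ => |y| ^ (-(3:ℝ) / 4))) :=
      integrableOn_abs_rpow_ball.integrable_indicator Metric.isOpen_ball.measurableSet
    have h2 : Integrable (fun y : ℝ => (1 + (y + c) ^ 2) ^ (-(5:ℝ) / 8)) :=
      integrable_bracket.comp_add_right c
    refine (h1.add h2).mono' (by fun_prop : Measurable _).aestronglyMeasurable
      (ae_of_all _ fun y => ?_)
    have hA : 0 ≤ |y| ^ (-(3:ℝ) / 4) := Real.rpow_nonneg (abs_nonneg y) _
    have hB : 0 ≤ (1 + (y + c) ^ 2) ^ (-(5:ℝ) / 8) := Real.rpow_nonneg (by positivity) _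
    have hB1 : (1 + (y + c) ^ 2) ^ (-(5:ℝ) / 8) ≤ 1 :=
      Real.rpow_le_one_of_one_le_of_nonpos (by nlinarith [sq_nonneg (y + c)]) (by norm_num)
    rw [Real.norm_eq_abs, abs_of_nonneg (mul_nonneg hA hB), Pi.add_apply]
    by_cases hy : y ∈ Metric.ball (0:ℝ) 1
    · rw [Set.indicator_of_mem hy]
      nlinarith
    · rw [Set.indicator_of_notMem hy]
      have hy1 : 1 ≤ |y| := by simpa using hy
      have hA1 : |y| ^ (-(3:ℝ) / 4) ≤ 1 := Real.rpow_le_one_of_one_le_of_nonpos hy1 (by norm_num)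
      nlinarith
  refine (key.comp_sub_right c).congr (ae_of_all _ fun x => ?_)
  simp only [sub_add_cancel]

/-- The `x`-weight `m(x) = (1 + Σₖ |x−eₖ|^{-3/4})(1+x²)^{-5/8}` is integrable on `ℝ`.
[folklore] -/
theorem integrable_m {e : Fin 5 → ℚ} {m : ℝ → ℝ}
    (hm : ∀ x, m x =
      (1 + ∑ k : Fin 5, |x - (e k : ℝ)| ^ (-(3:ℝ) / 4)) * (1 + x ^ 2) ^ (-(5:ℝ) / 8)) :
    Integrable m := by
  have h : m = fun x => (1 + x ^ 2) ^ (-(5:ℝ) / 8) +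
      ∑ k : Fin 5, |x - (e k : ℝ)| ^ (-(3:ℝ) / 4) * (1 + x ^ 2) ^ (-(5:ℝ) / 8) := by
    funext x
    rw [hm, add_mul, one_mul, Finset.sum_mul]
  rw [h]
  exact integrable_bracket.add (integrable_finsetSum _ fun k _ => integrable_weight_term _)

/-- The height weights `(1 + s^{-3/4})(1+s²)^{q}` (`q < -1/2`) are integrable on `(0,∞)`.
[folklore] -/
theorem integrableOn_height {q : ℝ} (hq : q < -(1:ℝ) / 2) :
    IntegrableOn (fun s : ℝ => (1 + s ^ (-(3:ℝ) / 4)) * (1 + s ^ 2) ^ q) (Ioi 0) := by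
  rw [← Ioc_union_Ioi_eq_Ioi zero_le_one, integrableOn_union]
  constructor
  · -- on `(0,1]`: dominated by `1 + s^{-3/4}`
    have h1 : IntegrableOn (fun s : ℝ => 1 + s ^ (-(3:ℝ) / 4)) (Ioc 0 1) := by
      refine IntegrableOn.add (integrableOn_const (by simp)) ?_
      have := intervalIntegral.intervalIntegrable_rpow' (a := 0) (b := 1) (r := -(3:ℝ) / 4)
        (by norm_num)
      rwa [intervalIntegrable_iff_integrableOn_Ioc_of_le zero_le_one] at this
    refine h1.mono' (by fun_prop : Measurable _).aestronglyMeasurable ?_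
    refine (ae_restrict_iff' measurableSet_Ioc).2 (ae_of_all _ fun s hs => ?_)
    have hs0 : 0 < s := hs.1
    have hA : 0 ≤ s ^ (-(3:ℝ) / 4) := Real.rpow_nonneg hs0.le _
    have hB : 0 ≤ (1 + s ^ 2) ^ q := Real.rpow_nonneg (by positivity) _
    have hB1 : (1 + s ^ 2) ^ q ≤ 1 :=
      Real.rpow_le_one_of_one_le_of_nonpos (by nlinarith) (by linarith)
    rw [Real.norm_eq_abs, abs_of_nonneg (mul_nonneg (by positivity) hB)]
    nlinarith
  · -- on `(1,∞)`: dominated by `2 s^{2q}`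
    have h1 : IntegrableOn (fun s : ℝ => 2 * s ^ (2 * q)) (Ioi 1) :=
      (integrableOn_Ioi_rpow_of_lt (by linarith) zero_lt_one).const_mul 2
    refine h1.mono' (by fun_prop : Measurable _).aestronglyMeasurable ?_
    refine (ae_restrict_iff' measurableSet_Ioi).2 (ae_of_all _ fun s hs => ?_)
    have hs1 : 1 < s := hs
    have hs0 : 0 < s := by linarith
    have hA1 : s ^ (-(3:ℝ) / 4) ≤ 1 := Real.rpow_le_one_of_one_le_of_nonpos hs1.le (by norm_num)
    have hA : 0 ≤ s ^ (-(3:ℝ) / 4) := Real.rpow_nonneg hs0.le _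
    have hB : 0 ≤ (1 + s ^ 2) ^ q := Real.rpow_nonneg (by positivity) _
    have hB2 : (1 + s ^ 2) ^ q ≤ s ^ (2 * q) := by
      calc (1 + s ^ 2) ^ q ≤ (s ^ 2) ^ q :=
            Real.rpow_le_rpow_of_nonpos (by positivity) (by linarith) (hq.le.trans (by norm_num))
        _ = s ^ (2 * q) := by rw [← Real.rpow_natCast s 2, ← Real.rpow_mul hs0.le]; norm_num
    rw [Real.norm_eq_abs, abs_of_nonneg (mul_nonneg (by positivity) hB)]
    nlinarith

end Bounds

open Bounds in
/-- **Kernel bounds.** For `z = x + is`, `s ≥ 0`, `x` off the branch points, with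
`m(x) = (1 + Σₖ |x−eₖ|^{−3/4}) (1+x²)^{−5/8}` (integrable on `ℝ`):
`|1/Φ(z)| ≤ C m(x) (1+s²)^{−5/8}`, `|z/Φ(z)| ≤ C m(x) (1+s²)^{−1/8}`, and for `s > 0`
`|Φ(z)⁻¹ Σⱼ (z−eⱼ)⁻¹| ≤ C m(x) (1+s^{−3/4}) (1+s²)^{−9/8}`,
`|(1 − (z/2) Σⱼ (z−eⱼ)⁻¹)/Φ(z)| ≤ C m(x) (1+s^{−3/4}) (1+s²)^{−5/8}`
(near a branch point `|z−eₖ|^{−3/2} ≤ (|x−eₖ| s)^{−3/4}`; far away `|z−eⱼ| ≥ |z|/2`); the two height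
weights `(1+s^{−3/4})(1+s²)^{−5/8}`, `(1+s^{−3/4})(1+s²)^{−5/4}` are integrable on `(0,∞)`.
[folklore] -/
theorem stub_bounds :
    ∀ (e : Fin 5 → ℚ), StrictMono e →
    ∀ (Φ : ℂ → ℂ), (∀ z, Φ z = ∏ j : Fin 5, Complex.sqrt (z - ((e j : ℝ) : ℂ))) →
    ∀ (m : ℝ → ℝ), (∀ x, m x =
        (1 + ∑ k : Fin 5, |x - (e k : ℝ)| ^ (-(3:ℝ) / 4)) * (1 + x ^ 2) ^ (-(5:ℝ) / 8)) →
      Integrable m ∧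
      IntegrableOn (fun s : ℝ => (1 + s ^ (-(3:ℝ) / 4)) * (1 + s ^ 2) ^ (-(5:ℝ) / 8)) (Ioi 0) ∧
      IntegrableOn (fun s : ℝ => (1 + s ^ (-(3:ℝ) / 4)) * (1 + s ^ 2) ^ (-(5:ℝ) / 4)) (Ioi 0) ∧
      ∃ C : ℝ, 0 < C ∧ ∀ (x s : ℝ), 0 ≤ s → (∀ j, x ≠ (e j : ℝ)) →
        ‖(Φ ((x : ℂ) + (s : ℂ) * Complex.I))⁻¹‖ ≤ C * m x * (1 + s ^ 2) ^ (-(5:ℝ) / 8) ∧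
        ‖((x : ℂ) + (s : ℂ) * Complex.I) / Φ ((x : ℂ) + (s : ℂ) * Complex.I)‖ ≤
          C * m x * (1 + s ^ 2) ^ (-(1:ℝ) / 8) ∧
        (0 < s →
          ‖(Φ ((x : ℂ) + (s : ℂ) * Complex.I))⁻¹ *
              ∑ j : Fin 5, ((x : ℂ) + (s : ℂ) * Complex.I - ((e j : ℝ) : ℂ))⁻¹‖ ≤
            C * m x * (1 + s ^ (-(3:ℝ) / 4)) * (1 + s ^ 2) ^ (-(9:ℝ) / 8) ∧
          ‖(1 - ((x : ℂ) + (s : ℂ) * Complex.I) / 2 *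
                ∑ j : Fin 5, ((x : ℂ) + (s : ℂ) * Complex.I - ((e j : ℝ) : ℂ))⁻¹) /
              Φ ((x : ℂ) + (s : ℂ) * Complex.I)‖ ≤
            C * m x * (1 + s ^ (-(3:ℝ) / 4)) * (1 + s ^ 2) ^ (-(5:ℝ) / 8)) := by
  intro e he Φ hΦ m hm
  refine ⟨integrable_m hm, integrableOn_height (by norm_num), integrableOn_height (by norm_num),
    ?_⟩
  -- the constants
  obtain ⟨δ, hδ, hsep⟩ := exists_sep he
  obtain ⟨M, hM_def⟩ : ∃ M : ℝ, M = ∑ j, |(e j : ℝ)| := ⟨_, rfl⟩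
  have hM0 : 0 ≤ M := by rw [hM_def]; exact Finset.sum_nonneg fun j _ => abs_nonneg _
  have hMj : ∀ j, |(e j : ℝ)| ≤ M := fun j => by
    rw [hM_def]
    exact Finset.single_le_sum (f := fun i => |(e i : ℝ)|) (fun i _ => abs_nonneg _)
      (Finset.mem_univ j)
  obtain ⟨A, hA_def⟩ : ∃ A : ℝ, A = 1 + (M + 1) ^ 2 := ⟨_, rfl⟩
  obtain ⟨D, hD_def⟩ : ∃ D : ℝ, D = (1 + δ ^ (-(3:ℝ) / 4)) ^ 4 := ⟨_, rfl⟩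
  have hA0 : 0 < A := by rw [hA_def]; positivity
  have hD0 : 0 < D := by rw [hD_def]; positivity
  refine ⟨5 * A ^ 5 * D, by positivity, fun x s hs hx => ?_⟩
  -- the point `z = x + is` and the `x`-weight `S`
  obtain ⟨z, hz_def⟩ : ∃ z : ℂ, z = (x : ℂ) + (s : ℂ) * Complex.I := ⟨_, rfl⟩
  obtain ⟨S, hS_def⟩ : ∃ S : ℝ, S = 1 + ∑ k, |x - (e k : ℝ)| ^ (-(3:ℝ) / 4) := ⟨_, rfl⟩
  rw [← hz_def]
  have hmx : m x = S * (1 + x ^ 2) ^ (-(5:ℝ) / 8) := by rw [hm x, hS_def]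
  obtain ⟨hB, hB'⟩ :=
    stub_boundsAux e M δ A D S x s z hMj hM0 hA_def hδ hsep hD_def hS_def hs hx hz_def
  rw [← hΦ z] at hB hB'
  -- geometry of `z`
  have hZ2 : ‖z‖ ^ 2 = x ^ 2 + s ^ 2 := by
    rw [hz_def, Complex.sq_norm, Complex.normSq_add_mul_I]
  have hx2 : x ^ 2 ≤ ‖z‖ ^ 2 := by rw [hZ2]; nlinarith
  have hs2 : s ^ 2 ≤ ‖z‖ ^ 2 := by rw [hZ2]; nlinarith
  have hω0 : 0 < 1 + ‖z‖ ^ 2 := by positivity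
  have hZle : ‖z‖ ≤ (1 + ‖z‖ ^ 2) ^ (1 / 2 : ℝ) := by
    rw [← Real.sqrt_eq_rpow]
    exact Real.le_sqrt_of_sq_le (by linarith)
  have hS0 : 0 ≤ S := by rw [hS_def]; positivity
  have hs34 : 0 ≤ s ^ (-(3:ℝ) / 4) := Real.rpow_nonneg hs _
  have hX0 : 0 ≤ (1 + x ^ 2) ^ (-(5:ℝ) / 8) := Real.rpow_nonneg (by positivity) _
  -- distributing the decay
  have sp0 : (1 + ‖z‖ ^ 2) ^ (-(5 / 4 : ℝ)) ≤
      (1 + x ^ 2) ^ (-(5:ℝ) / 8) * (1 + s ^ 2) ^ (-(5:ℝ) / 8) :=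
    decay_split hx2 hs2 (by norm_num) (by norm_num) (by norm_num)
  have sp1 : (1 + ‖z‖ ^ 2) ^ (-(3 / 4 : ℝ)) ≤
      (1 + x ^ 2) ^ (-(5:ℝ) / 8) * (1 + s ^ 2) ^ (-(1:ℝ) / 8) :=
    decay_split hx2 hs2 (by norm_num) (by norm_num) (by norm_num)
  have sp2 : (1 + ‖z‖ ^ 2) ^ (-(7 / 4 : ℝ)) ≤
      (1 + x ^ 2) ^ (-(5:ℝ) / 8) * (1 + s ^ 2) ^ (-(9:ℝ) / 8) :=
    decay_split hx2 hs2 (by norm_num) (by norm_num) (by norm_num)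
  have hZω : ‖z‖ * (1 + ‖z‖ ^ 2) ^ (-(5 / 4 : ℝ)) ≤ (1 + ‖z‖ ^ 2) ^ (-(3 / 4 : ℝ)) := by
    calc ‖z‖ * (1 + ‖z‖ ^ 2) ^ (-(5 / 4 : ℝ))
        ≤ (1 + ‖z‖ ^ 2) ^ (1 / 2 : ℝ) * (1 + ‖z‖ ^ 2) ^ (-(5 / 4 : ℝ)) :=
          mul_le_mul_of_nonneg_right hZle (by positivity)
      _ = _ := by rw [← Real.rpow_add hω0]; norm_num
  have hZω' : ‖z‖ * (1 + ‖z‖ ^ 2) ^ (-(7 / 4 : ℝ)) ≤ (1 + ‖z‖ ^ 2) ^ (-(5 / 4 : ℝ)) := by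
    calc ‖z‖ * (1 + ‖z‖ ^ 2) ^ (-(7 / 4 : ℝ))
        ≤ (1 + ‖z‖ ^ 2) ^ (1 / 2 : ℝ) * (1 + ‖z‖ ^ 2) ^ (-(7 / 4 : ℝ)) :=
          mul_le_mul_of_nonneg_right hZle (by positivity)
      _ = _ := by rw [← Real.rpow_add hω0]; norm_num
  -- the sum of the simple poles
  have hsum : ‖∑ j, (z - ((e j : ℝ) : ℂ))⁻¹‖ ≤ ∑ j, ‖z - ((e j : ℝ) : ℂ)‖⁻¹ := by
    have := norm_sum_le Finset.univ (fun j => (z - ((e j : ℝ) : ℂ))⁻¹)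
    simpa only [norm_inv] using this
  have hP1 : ‖(Φ z)⁻¹ * ∑ j, (z - ((e j : ℝ) : ℂ))⁻¹‖ ≤
      ‖(Φ z)⁻¹‖ * ∑ j, ‖z - ((e j : ℝ) : ℂ)‖⁻¹ :=
    (norm_mul_le _ _).trans (mul_le_mul_of_nonneg_left hsum (norm_nonneg _))
  have hK0 : 0 ≤ A ^ 5 * D * S := by positivity
  refine ⟨?_, ?_, fun hs0 => ⟨?_, ?_⟩⟩
  · -- `1/Φ`
    have h1 : A ^ 5 * D * S * (1 + ‖z‖ ^ 2) ^ (-(5 / 4 : ℝ)) ≤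
        A ^ 5 * D * S * ((1 + x ^ 2) ^ (-(5:ℝ) / 8) * (1 + s ^ 2) ^ (-(5:ℝ) / 8)) :=
      mul_le_mul_of_nonneg_left sp0 hK0
    have h2 : 0 ≤ A ^ 5 * D * S * ((1 + x ^ 2) ^ (-(5:ℝ) / 8) * (1 + s ^ 2) ^ (-(5:ℝ) / 8)) := by
      positivity
    rw [hmx]
    linarith
  · -- `z/Φ`
    rw [div_eq_mul_inv, norm_mul]
    have h1 : ‖z‖ * ‖(Φ z)⁻¹‖ ≤ ‖z‖ * (A ^ 5 * D * S * (1 + ‖z‖ ^ 2) ^ (-(5 / 4 : ℝ))) :=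
      mul_le_mul_of_nonneg_left hB (norm_nonneg _)
    have h2 : A ^ 5 * D * S * (‖z‖ * (1 + ‖z‖ ^ 2) ^ (-(5 / 4 : ℝ))) ≤
        A ^ 5 * D * S * (1 + ‖z‖ ^ 2) ^ (-(3 / 4 : ℝ)) := mul_le_mul_of_nonneg_left hZω hK0
    have h3 : A ^ 5 * D * S * (1 + ‖z‖ ^ 2) ^ (-(3 / 4 : ℝ)) ≤
        A ^ 5 * D * S * ((1 + x ^ 2) ^ (-(5:ℝ) / 8) * (1 + s ^ 2) ^ (-(1:ℝ) / 8)) :=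
      mul_le_mul_of_nonneg_left sp1 hK0
    have h4 : 0 ≤ A ^ 5 * D * S * ((1 + x ^ 2) ^ (-(5:ℝ) / 8) * (1 + s ^ 2) ^ (-(1:ℝ) / 8)) := by
      positivity
    rw [hmx]
    linarith
  · -- `Φ⁻¹ Σⱼ (z−eⱼ)⁻¹`
    have h0 := hB' hs0
    have h1 : 5 * A ^ 5 * D * S * (1 + s ^ (-(3:ℝ) / 4)) * (1 + ‖z‖ ^ 2) ^ (-(7 / 4 : ℝ)) ≤
        5 * A ^ 5 * D * S * (1 + s ^ (-(3:ℝ) / 4)) *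
          ((1 + x ^ 2) ^ (-(5:ℝ) / 8) * (1 + s ^ 2) ^ (-(9:ℝ) / 8)) :=
      mul_le_mul_of_nonneg_left sp2 (by positivity)
    rw [hmx]
    linarith
  · -- `(1 − (z/2) Σⱼ (z−eⱼ)⁻¹)/Φ`
    have h0 := hB' hs0
    rw [div_eq_mul_inv _ (Φ z), norm_mul]
    have hnum : ‖1 - z / 2 * ∑ j, (z - ((e j : ℝ) : ℂ))⁻¹‖ ≤
        1 + ‖z‖ / 2 * ∑ j, ‖z - ((e j : ℝ) : ℂ)‖⁻¹ := by
      refine (norm_sub_le _ _).trans ?_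
      rw [norm_one, norm_mul, norm_div, Complex.norm_ofNat]
      have h2 : ‖z‖ / 2 * ‖∑ j, (z - ((e j : ℝ) : ℂ))⁻¹‖ ≤ ‖z‖ / 2 * ∑ j, ‖z - ((e j : ℝ) : ℂ)‖⁻¹ :=
        mul_le_mul_of_nonneg_left hsum (by positivity)
      linarith
    have h1 : ‖1 - z / 2 * ∑ j, (z - ((e j : ℝ) : ℂ))⁻¹‖ * ‖(Φ z)⁻¹‖ ≤
        (1 + ‖z‖ / 2 * ∑ j, ‖z - ((e j : ℝ) : ℂ)‖⁻¹) * ‖(Φ z)⁻¹‖ :=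
      mul_le_mul_of_nonneg_right hnum (norm_nonneg _)
    have h2 : (1 + ‖z‖ / 2 * ∑ j, ‖z - ((e j : ℝ) : ℂ)‖⁻¹) * ‖(Φ z)⁻¹‖ =
        ‖(Φ z)⁻¹‖ + ‖z‖ / 2 * (‖(Φ z)⁻¹‖ * ∑ j, ‖z - ((e j : ℝ) : ℂ)‖⁻¹) := by ring
    have h3 : ‖z‖ * (‖(Φ z)⁻¹‖ * ∑ j, ‖z - ((e j : ℝ) : ℂ)‖⁻¹) ≤
        5 * A ^ 5 * D * S * (1 + s ^ (-(3:ℝ) / 4)) * (1 + ‖z‖ ^ 2) ^ (-(5 / 4 : ℝ)) := by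
      calc ‖z‖ * (‖(Φ z)⁻¹‖ * ∑ j, ‖z - ((e j : ℝ) : ℂ)‖⁻¹)
          ≤ ‖z‖ * (5 * A ^ 5 * D * S * (1 + s ^ (-(3:ℝ) / 4)) * (1 + ‖z‖ ^ 2) ^ (-(7 / 4 : ℝ))) :=
            mul_le_mul_of_nonneg_left h0 (norm_nonneg _)
        _ = 5 * A ^ 5 * D * S * (1 + s ^ (-(3:ℝ) / 4)) *
              (‖z‖ * (1 + ‖z‖ ^ 2) ^ (-(7 / 4 : ℝ))) := by ring
        _ ≤ _ := mul_le_mul_of_nonneg_left hZω' (by positivity)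
    have h4 : A ^ 5 * D * S * (1 + ‖z‖ ^ 2) ^ (-(5 / 4 : ℝ)) ≤
        A ^ 5 * D * S * (1 + s ^ (-(3:ℝ) / 4)) * (1 + ‖z‖ ^ 2) ^ (-(5 / 4 : ℝ)) := by
      have : 0 ≤ A ^ 5 * D * S * (1 + ‖z‖ ^ 2) ^ (-(5 / 4 : ℝ)) := by positivity
      nlinarith
    have h5 : A ^ 5 * D * S * (1 + s ^ (-(3:ℝ) / 4)) * (1 + ‖z‖ ^ 2) ^ (-(5 / 4 : ℝ)) ≤
        A ^ 5 * D * S * (1 + s ^ (-(3:ℝ) / 4)) *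
          ((1 + x ^ 2) ^ (-(5:ℝ) / 8) * (1 + s ^ 2) ^ (-(5:ℝ) / 8)) :=
      mul_le_mul_of_nonneg_left sp0 (by positivity)
    have h6 : 0 ≤ A ^ 5 * D * S * (1 + s ^ (-(3:ℝ) / 4)) *
        ((1 + x ^ 2) ^ (-(5:ℝ) / 8) * (1 + s ^ 2) ^ (-(5:ℝ) / 8)) := by positivity
    rw [hmx]
    linarith [h1, h2, h3, hB, h4, h5, h6]

end Summit.KontsevichZagierPeriods.UnfoldedStokes.HyperellipticRiemannRelationLine
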